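import Mathlib
import HarnessLib
import Summits.HubbardSuperconductivity.HubbardSuperconductivity.Theorems.KLProgrammeKLRegimeEnginePairTransferOutClassFrameShiftSizesSucc
import Summits.HubbardSuperconductivity.HubbardSuperconductivity.Theorems.KLProgrammeKLRegimeEngineV8DefsQ9dG
import Summits.HubbardSuperconductivity.HubbardSuperconductivity.Theorems.KLProgrammeKLRegimeEngineV8DefsU12bGQ
import Summits.HubbardSuperconductivity.HubbardSuperconductivity.Theorems.KLProgrammeKLRegimeEngineV8DefsL4

/-!
# Route `KLProgramme` — ENGINE item stmt-HubbardSuperconductivity-20437 `KLRegimeEngineV17F2`, registration r16 V2 (α1) «A24∪A25∪Z∪α1»-G14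
# (image `engine-flow-v2x.r16-A24A25Za1-G14.lean` 27cd7ed0f55f17c0, `payload.skeleton` ts 2026-08-29T08:47:19Z):
# ROW (c) `stub_engine_step_values` f2bba37a7dce — THE `hshift` CONJUNCT OF THE (c)-OUT PACKAGE AT THE V2 TOKENS (cell gate-hubbard-kl, seat p2 g27)

WHAT.  The (c)-OUT closer of record `rowC_hexOut_of_pkg hexOutPkg` (…EngineV17F2ClosersVGQOut, k3c2-p2 g24, p712526) takes ONE ∃-package per
`(n, Qm ∉ class(n+1), x, y ∈ klBall)` whose LAST conjunct is the frame shift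
`‖𝒞ₙ₊₁[Kₙ₊₁](Qm;x,y) − 𝒞ₙ₊₁[Kₙ](Qm;x,y)‖ ≤ frameShiftBar P (klEngQ9dG klEngGeo14 P R) U (n+1)` (owner: p2 lineage).  The p2 producers of record
`hshift_succ_of_sizes_geom` / `hshift_lastScale_succ_of_size` (…PairTransferOutClassFrameShiftSizesSucc, p2 g25; doors p2 g23/g24) are GENERIC in the geometry
constant `G` and the engine-constant bundle `Q`, with the doors `(klEngQ8 P R).IsRaiseOf Q`, `U ≤ klEngU₀4 P R c`, `klEngL₃ β U ≤ L`, `R.WF`, `0 < β`.  This file performs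
the V2-TOKEN BOOKKEEPING ONCE, so that whoever assembles `hexOutPkg` writes the `hshift` conjunct as ONE literal call under row (c)'s own binder prefix:
* **`rowC_hshift_of_sizes`** — regular steps `n + 1 ≤ n_β`: row (c)'s prefix facts at the V2 tokens (`R.WF2`, `P.WF`, `μ ∈ klWindowC`, `0 < U ≤ klEngU₀12GQ klEngGeo14
  (klEngQ9dG klEngGeo14 P R) P R c`, `klBetaMin ≤ β`, `klEngL₄ P R β U ≤ L`, history `HistP … klEngGeo14 P (klEngQ9dG klEngGeo14 P R) R … 0 (n+1)`) + the two
  partition-function facts of the scale-`(n+1)` mismatch path + the FOUR sizes `a ≤ 2²⁸, n₆, s₂, n₄` (E1 / closer) + the room line ⇒ the conjunct VERBATIM;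
  doors discharged in-text: `isRaiseOf_klEngQ9dG_klEngQ8 klEngGeo14`, `klEngU₀12GQ_le_klEngU₀4`, `klEngL₃_le_of_klEngL₄_le`, `hR.1`, `pos_of_klBetaMin_le`;
* **`rowC_hshift_lastScale_of_size`** — the last index `n_β + 1`: history + `IsUnit Z(K_{n_β+1})` + ONE size `a ≤ 2²⁸` ⇒ the conjunct with the lower frame
  `klFlowFrameU … (nScales β)`.
Pure token instantiation of landed theorems (no definition, no instance, no notation); the sizes and the partition-function facts are HYPOTHESES (E1-class sector
estimates / engine `Z`-facts, OPEN); nothing here asserts (c), any row of 20437, VL, K3, the Kohn–Luttinger margin or superconductivity in the Hubbard model.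
0 kit · 0 lit.  References: BGM 2006 §2.3 (2.21)–(2.24), §3 (3.3) (the frame/counterterm shift between consecutive scales) [cite: BenfattoGiulianiMastropietro2006].
-/

noncomputable section

namespace Summit.HubbardSuperconductivity.HubbardSuperconductivity.Theorems.EngineV8

set_option linter.dupNamespace false -- summit = problem name (single-conjunct summit), D-0017

open Real Finset Literature.MathematicalPhysics.QuantumLattice Literature.Probability.LatticeModels GrassmannAlgebra
open Summit.HubbardSuperconductivity.HubbardSuperconductivity.Theorems.KLProgrammeLegKernels
open Summit.HubbardSuperconductivity.HubbardSuperconductivity.Theorems.KLRegimeSplit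
open Summit.HubbardSuperconductivity.HubbardSuperconductivity.Theorems.TwoVolumeDefect
open Summit.HubbardSuperconductivity.HubbardSuperconductivity.Theorems.TwoPointAssembly

section Model

variable {L M : ℕ} [NeZero L] [NeZero M] {P : SplitConsts} {R : RenConsts} {β U μ c : ℝ} {n : ℕ}

set_option maxHeartbeats 400000 in -- long binder list
/-- **ROW (c)'s `hshift` CONJUNCT AT THE V2 TOKENS, REGULAR STEPS `n + 1 ≤ n_β`**: row (c)'s binder-prefix facts at `(klEngGeo14, klEngQ9dG klEngGeo14 P R)` + the two
partition-function facts of the scale-`(n+1)` mismatch path + four sizes `a, n₆, s₂, n₄` + the room line ⇒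
`‖𝒞ₙ₊₁[Kₙ₊₁](Qm;x,y) − 𝒞ₙ₊₁[Kₙ](Qm;x,y)‖ ≤ frameShiftBar P (klEngQ9dG klEngGeo14 P R) U (n+1)` — the last conjunct of `hexOutPkg` in `rowC_hexOut_of_pkg`, by
`hshift_succ_of_sizes_geom` with the V2 doors discharged. [cite: BenfattoGiulianiMastropietro2006, §2.3 (2.21)–(2.24), §3 (3.3)] -/
theorem rowC_hshift_of_sizes (hR : R.WF2) (hP : P.WF) (hμ : μ ∈ klWindowC) (hU : 0 < U)
    (hUle : U ≤ klEngU₀12GQ klEngGeo14 (klEngQ9dG klEngGeo14 P R) P R c) (hβ : klBetaMin ≤ β) (hL : klEngL₄ P R β U ≤ L)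
    (hnβ : n + 1 ≤ nScales β)
    (hhist : HistP klPredsV17F2 L M klEngGeo14 P (klEngQ9dG klEngGeo14 P R) R β U μ 0 (n + 1))
    {Qm x y : TorusSite 2 L}
    (hZ₂ : effPartitionFn ℂ (normalCovariance L M (uvSymbolCT L M β μ (klFlowFrameU L M β U μ (n + 1)) (klScale klE0 (n + 1))))
      (hubbardInteraction L M β U + counterQuadratic L M β (klFlowFrameU L M β U μ (n + 1))) ≠ 0)
    {s₀ s₁ : FreqMomentum L M × Fin 2 → ℂ}
    (hs₀ : s₀ = uvSymbolCT L M β μ (klFlowFrameU L M β U μ n) (klScale klE0 (n + 1)))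
    (hs₁ : s₁ = fun ks => uvSymbolCT L M β μ (klFlowFrameU L M β U μ (n + 1)) (klScale klE0 (n + 1)) ks /
      (1 + uvSymbolCT L M β μ (klFlowFrameU L M β U μ (n + 1)) (klScale klE0 (n + 1)) ks *
        (((fsub (klFlowFrameU L M β U μ (n + 1)) (klFlowFrameU L M β U μ n)).eval (latticeMomentum L ks.1.2) / (β * (L : ℝ) ^ 2) : ℝ) : ℂ)))
    (hZ : ∀ t ∈ Set.Icc (0 : ℝ) 1, effPartitionFn ℂ (normalCovariance L M s₀ + ((t : ℂ)) • (normalCovariance L M s₁ - normalCovariance L M s₀))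
      (hubbardInteraction L M β U + counterQuadratic L M β (klFlowFrameU L M β U μ n)) ≠ 0)
    {a n₆ s₂ n₄ : ℝ}
    (ha0 : 0 ≤ a)
    (ha : a ≤ 2 ^ 28)
    (hn₆ : 0 ≤ n₆)
    (hs₂ : 0 ≤ s₂)
    (hn₄ : 0 ≤ n₄)
    (hroom : 547400 * (8 / Real.pi * 2946 * n₆ + 4 * s₂ * n₄) ≤ klHshiftC)
    (hC4 : ‖klPairAmplitude L M β U μ (klFlowFrameU L M β U μ (n + 1)) (n + 1) Qm x y‖ ≤ a * (P.Klam * |U|))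
    (hN6 : ∀ t ∈ Set.Icc (0 : ℝ) 1, ∀ A : HubbardFieldIdx L M,
      ‖kernel ℂ (effAction ℂ (normalCovariance L M s₀ + ((t : ℂ)) • (normalCovariance L M s₁ - normalCovariance L M s₀))
        (hubbardInteraction L M β U + counterQuadratic L M β (klFlowFrameU L M β U μ n))) 6
        (Fin.snoc (Fin.snoc ![(((omega0 M, y), 0), 0), ((((omega0 M).rev, Qm - y), 1), 0), ((((omega0 M).rev, Qm - x), 1), 1), (((omega0 M, x), 0), 1)] (A.1, 1 - A.2) : Fin 5 → HubbardFieldIdx L M) A)‖ ≤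
          n₆ * (P.Klam * U) ^ 2 / klScale klE0 (n + 1) / (720 * (β * (L : ℝ) ^ 2) ^ 5))
    (hS : ∀ t ∈ Set.Icc (0 : ℝ) 1, ∀ i : Fin 4,
      |nambuXiCT L μ (klFlowFrameU L M β U μ n) ((![(((omega0 M, y), 0), 0), ((((omega0 M).rev, Qm - y), 1), 0), ((((omega0 M).rev, Qm - x), 1), 1), (((omega0 M, x), 0), 1)] :
              Fin 4 → HubbardFieldIdx L M) i).1.1.2| < 5 * klScale klE0 (n + 1) / 4 →
      ‖kernel ℂ (effAction ℂ (normalCovariance L M s₀ + ((t : ℂ)) • (normalCovariance L M s₁ - normalCovariance L M s₀))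
        (hubbardInteraction L M β U + counterQuadratic L M β (klFlowFrameU L M β U μ n))) 2
        ![((((![(((omega0 M, y), 0), 0), ((((omega0 M).rev, Qm - y), 1), 0), ((((omega0 M).rev, Qm - x), 1), 1), (((omega0 M, x), 0), 1)] :
              Fin 4 → HubbardFieldIdx L M) i).1,
            1 - ((![(((omega0 M, y), 0), 0), ((((omega0 M).rev, Qm - y), 1), 0), ((((omega0 M).rev, Qm - x), 1), 1), (((omega0 M, x), 0), 1)] :
              Fin 4 → HubbardFieldIdx L M) i).2) : HubbardFieldIdx L M),
          (![(((omega0 M, y), 0), 0), ((((omega0 M).rev, Qm - y), 1), 0), ((((omega0 M).rev, Qm - x), 1), 1), (((omega0 M, x), 0), 1)] :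
              Fin 4 → HubbardFieldIdx L M) i]‖ ≤ s₂ * |U| * klScale klE0 (n + 1) / (2 * (β * (L : ℝ) ^ 2)))
    (hN4 : ∀ t ∈ Set.Icc (0 : ℝ) 1,
      ‖kernel ℂ (effAction ℂ (normalCovariance L M s₀ + ((t : ℂ)) • (normalCovariance L M s₁ - normalCovariance L M s₀))
        (hubbardInteraction L M β U + counterQuadratic L M β (klFlowFrameU L M β U μ n))) 4
        ![(((omega0 M, y), 0), 0), ((((omega0 M).rev, Qm - y), 1), 0), ((((omega0 M).rev, Qm - x), 1), 1), (((omega0 M, x), 0), 1)]‖ ≤ n₄ * (P.Klam * |U|) / (24 * (β * (L : ℝ) ^ 2) ^ 3)) :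
    ‖klPairAmplitude L M β U μ (klFlowFrameU L M β U μ (n + 1)) (n + 1) Qm x y - klPairAmplitude L M β U μ (klFlowFrameU L M β U μ n) (n + 1) Qm x y‖ ≤
      frameShiftBar P (klEngQ9dG klEngGeo14 P R) U (n + 1) :=
  hshift_succ_of_sizes_geom hμ (klEngL₃_le_of_klEngL₄_le hL) hβ hnβ hhist hP hR.1 (isRaiseOf_klEngQ9dG_klEngQ8 klEngGeo14 P R) hU
    (hUle.trans (klEngU₀12GQ_le_klEngU₀4 klEngGeo14 (klEngQ9dG klEngGeo14 P R) P R c)) (KLRegimeSplit.pos_of_klBetaMin_le hβ) hZ₂ hs₀ hs₁ hZ ha0 ha hn₆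
    hs₂ hn₄ hroom hC4 hN6 hS hN4

/-- **ROW (c)'s `hshift` CONJUNCT AT THE V2 TOKENS, LAST INDEX `n_β + 1`**: history + `IsUnit Z(K_{n_β+1})` + ONE size `a ≤ 2²⁸` ⇒
`‖𝒞_{n_β+1}[K_{n_β+1}] − 𝒞_{n_β+1}[K_{n_β}]‖ ≤ frameShiftBar P (klEngQ9dG klEngGeo14 P R) U (n_β+1)`, by `hshift_lastScale_succ_of_size` with the V2 doors discharged.
[cite: BenfattoGiulianiMastropietro2006, §2.3 (2.24)] -/
theorem rowC_hshift_lastScale_of_size (hR : R.WF2) (hP : P.WF) (hU : 0 < U)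
    (hUle : U ≤ klEngU₀12GQ klEngGeo14 (klEngQ9dG klEngGeo14 P R) P R c) (hβ : klBetaMin ≤ β)
    (hhist : HistP klPredsV17F2 L M klEngGeo14 P (klEngQ9dG klEngGeo14 P R) R β U μ 0 (nScales β + 1)) {Qm x y : TorusSite 2 L}
    (hZ₂ : IsUnit (effPartitionFn ℂ (normalCovariance L M (uvSymbolCT L M β μ (klFlowFrameU L M β U μ (nScales β + 1)) (klScale klE0 (nScales β + 1))))
      (hubbardInteraction L M β U + counterQuadratic L M β (klFlowFrameU L M β U μ (nScales β + 1)))))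
    {a : ℝ} (ha0 : 0 ≤ a) (ha : a ≤ 2 ^ 28)
    (hC4 : ‖klPairAmplitude L M β U μ (klFlowFrameU L M β U μ (nScales β + 1)) (nScales β + 1) Qm x y‖ ≤ a * (P.Klam * |U|)) :
    ‖klPairAmplitude L M β U μ (klFlowFrameU L M β U μ (nScales β + 1)) (nScales β + 1) Qm x y -
        klPairAmplitude L M β U μ (klFlowFrameU L M β U μ (nScales β)) (nScales β + 1) Qm x y‖ ≤ frameShiftBar P (klEngQ9dG klEngGeo14 P R) U (nScales β + 1) :=
  hshift_lastScale_succ_of_size hhist hP hR.1 (isRaiseOf_klEngQ9dG_klEngQ8 klEngGeo14 P R) hU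
    (hUle.trans (klEngU₀12GQ_le_klEngU₀4 klEngGeo14 (klEngQ9dG klEngGeo14 P R) P R c)) (KLRegimeSplit.pos_of_klBetaMin_le hβ) hZ₂ ha0 ha hC4

end Model

end Summit.HubbardSuperconductivity.HubbardSuperconductivity.Theorems.EngineV8

end
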